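import Literature.IUT.HodgeTheaters.TemperedCoveringsSlimness
import HarnessLib

/-!
# [IUTchI] Corollary 2.3 (iii), first sentence: the slimness input is `ℍ`-FREE — the printed proof gives
# "`Z_{Δ̂_X}(J ∩ Ker(Δ̂_X ↠ Π̂_𝔾)) ⊆ J`", hence slimness of EVERY closed subgroup between `Ker(Δ̂_X ↠ Π̂_𝔾)` and `Δ̂_X`

Mochizuki, *Inter-universal Teichmüller theory I: construction of Hodge theaters*, kurims
manuscript (May 2020), §2, Corollary 2.3 (iii) p. 47 ("Then `Δ̂_{X,ℍ}` is slim"), proof p. 48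
l. 30 – p. 49 l. 32 [cite: Mochizuki2012, Cor 2.3(iii) pp.47-49] (D-0012 claim key; series status
DISPUTED; nothing of the series is asserted here).  Node `IUTchI:Cor2.3(iii)` (board holder
abc-iut-w4-d058; kernel of record `TemperedCoveringsCor23iiiProofs.lean` p411765; slimness tower
`TemperedCoveringsSlimness.lean` p412841, abc-iut-w4-d070; plan/GAP-LEDGER.md G-w4d058-1).

PROOF-ONLY sequel (no definition, no new named fact) recording an OBSERVATION ABOUT THE PRINTED PROOF
that sharpens the residual input of the node.  In the proof of the first sentence of Cor. 2.3 (iii)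
the hypothesis "`α ∈ Δ̂_{X,ℍ}` commutes with `J_ℍ := J ∩ Δ̂_{X,ℍ}`" (p. 48) is used ONLY through the
elements of "`Ker(J_v ⊆ J ⊆ Δ̂_X ↠ Π̂_𝔾) ⊆ J_v ∩ J_ℍ`" (p. 49 l. 9–10: it is these elements whose
images generate the maximal pro-`l` quotient of `J_v` in (†), and whose `α`-invariance feeds
[AbsTopII] Prop. 1.3 (iv) / [NodNon] Prop. 3.9 (i) and the [SemiAnbd] Cor. 3.11 step) — in the
kernel form of abc-iut-w4-d070 this is visible as the fact that `mem_level_of_comm_of_inputs` /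
`act_eq_of_comm` apply their commutation hypothesis `ha` only to elements of `D.ρHat.ker`.
Consequently the printed per-level conclusion is the `ℍ`-FREE statement

  (KER-LEVEL)  every `α ∈ Δ̂_X` commuting with `J ∩ Ker(Δ̂_X ↠ Π̂_𝔾)` lies in `J`,

i.e. `Z_{Δ̂_X}(J ∩ Ker(Δ̂_X ↠ Π̂_𝔾)) ⊆ J` for every normal open `J ⊆ Δ̂_X`, and the tower step then
gives the slimness of EVERY subgroup `S` with `Ker(Δ̂_X ↠ Π̂_𝔾) ⊆ S ⊆ Δ̂_X` — in particular of
`Δ̂_{X,ℍ}` for EVERY sub-semi-graph `ℍ` AT ONCE (the [IUTchII] Prop. 2.2 / Def. 2.3 consumers use two,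
`ℍ = Γ_X^•` and `ℍ = Γ_X^▶`, kurims [IUTchII] p. 66) and of `Δ̂_X` itself:

* B′ `isSlimGroup_of_ker_le_of_levels` — tower step for any `S ⊇ Ker ρ̂` from (KER-LEVEL) over a
  cofinal family of normal open `J`; corollaries `isSlimGroup_deltaHatH_of_ker_levels` (the typed
  `S = Δ̂_{X,ℍ}`), `isSlimGroup_top_of_ker_levels` (`S = Δ̂_X`); `hlevel_of_kerLevel` ((KER-LEVEL) ⇒
  abc-iut-w4-d070's `ℍ`-form level hypothesis);
* C′ `act_eq_of_comm_ker`, `mem_level_of_comm_ker_of_inputs` — ONE LEVEL, condition (a):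
  (KER-LEVEL) from EXACTLY the printed per-level inputs of `mem_level_of_comm_of_inputs` (same
  binders, same docstring semantics; only the commutation premise is weakened to kernel elements —
  the proofs are abc-iut-w4-d070's, verbatim up to that premise);
* D′ `slim_of_cor23Hyp_of_ker_levels` — the typed field `D.Cor23Hyp → IsSlimGroup D.deltaHatH` from
  the `ℍ`-free level conclusions under (a) / (b), as in `slim_of_cor23Hyp_of_levels`.

USE (residual bookkeeping for G-w4d058-1, not a discharge): a consumer that today takes
`IsSlimGroup Δ̂_{X,ℍ}` BY NAME once per `ℍ` may instead take the single `ℍ`-free family (KER-LEVEL)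
— or its consequence `IsSlimGroup` of `Ker ρ̂ ≤ S` — for all its `ℍ` simultaneously; the per-level
merge obligations ((A3), the Cor. 3.11 step, `(J*)^{ab}`, [Config] Prop. 1.4) are unchanged and are
properties of `(X, 𝔾, J)` alone.  Topological side conditions as in the predecessor file.  Nothing
here bears on [IUTchIII] Cor. 3.12; typed ≠ discharged.
-/

namespace Literature.IUT.HodgeTheaters

open Pointwise Topology
open Literature.AlgebraicGeometry.Frobenioids (IsSlimGroup)
open Literature.AnabelianGeometry.SemiGraphs (IsProSigma)

universe u

namespace StableCurveTemperedData

variable (D : StableCurveTemperedData.{u})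

/-! ### B′. The tower step for any subgroup `S` with `Ker(Δ̂_X ↠ Π̂_𝔾) ⊆ S ⊆ Δ̂_X` -/

/-- **Tower step, `ℍ`-free form.**  If over a family of normal open subgroups `J_i ⊆ Δ̂_X` cofinal
among the open normal subgroups (`hcof`) every `α ∈ Δ̂_X` commuting with `J_i ∩ Ker(Δ̂_X ↠ Π̂_𝔾)`
lies in `J_i` (`hker`, the printed per-level conclusion in the form the proof actually establishes
it, p. 49: only elements of "`Ker(J_v ⊆ J ⊆ Δ̂_X ↠ Π̂_𝔾) ⊆ J_v ∩ J_ℍ`" are used), then EVERY subgroup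
`S` of `Δ̂_X` containing `Ker(Δ̂_X ↠ Π̂_𝔾)` is slim (subspace topology).  Side conditions: `Π̂_X`
Hausdorff, totally disconnected, `Δ̂_X` closed. [cite: Mochizuki2012, Cor 2.3(iii) pp.48-49] -/
theorem isSlimGroup_of_ker_le_of_levels [T2Space D.PiHat] [TotallyDisconnectedSpace D.PiHat]
    (hΔc : IsClosed (D.DeltaHat : Set D.PiHat)) (S : Subgroup D.DeltaHat) (hS : D.ρHat.ker ≤ S)
    {I : Type*} (J : I → Subgroup D.DeltaHat)
    (hcof : ∀ W : Subgroup D.DeltaHat, W.Normal → IsOpen (W : Set D.DeltaHat) → ∃ i, J i ≤ W)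
    (hker : ∀ i (a : D.DeltaHat), (∀ x ∈ J i, x ∈ D.ρHat.ker → a * x = x * a) → a ∈ J i) :
    IsSlimGroup S := by
  haveI : CompactSpace D.DeltaHat := isCompact_iff_compactSpace.mp hΔc.isCompact
  refine isSlimGroup_subgroup_of_openNormal S fun U a _ hcomm => ?_
  refine eq_one_of_forall_mem_openNormalSubgroup fun W => ?_
  haveI : (U.toSubgroup ⊓ W.toSubgroup).Normal := Subgroup.normal_inf_normal _ _
  obtain ⟨i, hi⟩ := hcof (U.toSubgroup ⊓ W.toSubgroup) inferInstance (U.isOpen'.inter W.isOpen')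
  exact (hi (hker i a fun x hxJ hxK => hcomm x (hi hxJ).1 (hS hxK))).2

/-- **`Δ̂_{X,ℍ}` is slim from the `ℍ`-free level conclusions** (the typed case `S = Δ̂_{X,ℍ}`,
`Ker(Δ̂_X ↠ Π̂_𝔾) ⊆ Δ̂_{X,ℍ}` being `ker_ρHat_le_deltaHatH`): Cor. 2.3 (iii), first sentence, for the
datum's `ℍ` — and, by `isSlimGroup_of_ker_le_of_levels`, for any other sub-semi-graph's `Δ̂_{X,ℍ′}`
from the SAME hypotheses. [cite: Mochizuki2012, Cor 2.3(iii) pp.47-49] -/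
theorem isSlimGroup_deltaHatH_of_ker_levels [T2Space D.PiHat] [TotallyDisconnectedSpace D.PiHat]
    (hΔc : IsClosed (D.DeltaHat : Set D.PiHat)) {I : Type*} (J : I → Subgroup D.DeltaHat)
    (hcof : ∀ W : Subgroup D.DeltaHat, W.Normal → IsOpen (W : Set D.DeltaHat) → ∃ i, J i ≤ W)
    (hker : ∀ i (a : D.DeltaHat), (∀ x ∈ J i, x ∈ D.ρHat.ker → a * x = x * a) → a ∈ J i) :
    IsSlimGroup D.deltaHatH :=
  D.isSlimGroup_of_ker_le_of_levels hΔc D.deltaHatH D.ker_ρHat_le_deltaHatH J hcof hker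

/-- **`Δ̂_X` itself is slim from the same `ℍ`-free level conclusions** (`S = ⊤`; the text's remark
that its argument gives "two distinct proofs of the slimness", p. 48, read at `ℍ = 𝔾`).
[cite: Mochizuki2012, Cor 2.3(iii) pp.48-49] -/
theorem isSlimGroup_top_of_ker_levels [T2Space D.PiHat] [TotallyDisconnectedSpace D.PiHat]
    (hΔc : IsClosed (D.DeltaHat : Set D.PiHat)) {I : Type*} (J : I → Subgroup D.DeltaHat)
    (hcof : ∀ W : Subgroup D.DeltaHat, W.Normal → IsOpen (W : Set D.DeltaHat) → ∃ i, J i ≤ W)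
    (hker : ∀ i (a : D.DeltaHat), (∀ x ∈ J i, x ∈ D.ρHat.ker → a * x = x * a) → a ∈ J i) :
    IsSlimGroup (⊤ : Subgroup D.DeltaHat) :=
  D.isSlimGroup_of_ker_le_of_levels hΔc ⊤ le_top J hcof hker

/-- (KER-LEVEL) is the STRONGER per-level statement: it implies abc-iut-w4-d070's `ℍ`-form level
hypothesis `hlevel` of `isSlimGroup_deltaHatH_of_levels` (commuting with all of `J ∩ Δ̂_{X,ℍ}` is
more than commuting with `J ∩ Ker(Δ̂_X ↠ Π̂_𝔾)`). [cite: Mochizuki2012, Cor 2.3(iii) p.49] -/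
theorem hlevel_of_kerLevel (J : Subgroup D.DeltaHat)
    (hker : ∀ a : D.DeltaHat, (∀ x ∈ J, x ∈ D.ρHat.ker → a * x = x * a) → a ∈ J)
    (a : D.DeltaHat) (ha : ∀ x ∈ J, x ∈ D.deltaHatH → a * x = x * a) : a ∈ J :=
  hker a fun x hxJ hxK => ha x hxJ (D.ker_ρHat_le_deltaHatH hxK)

/-! ### C′. One level `J`, condition (a): (KER-LEVEL) from the printed per-level inputs -/

/-- **"`α` fixes `v`", kernel form** — abc-iut-w4-d070's `act_eq_of_comm` with the commutation
premise restricted to `J ∩ Ker(Δ̂_X ↠ Π̂_𝔾)` (the only elements its proof uses: those of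
`J_v ∩ Ker(Δ̂_X ↠ Π̂_𝔾)`, p. 49 l. 9–22).  Inputs `V`, `act`, `Ks`, `P_v` (`hequiv`), **(A3)** (`hA3`),
`J_v` (`hJvP`, `hJvJ`) and (†) in the currency of (A3) (`hdag`) exactly as there.
[cite: Mochizuki2012, Cor 2.3(iii) p.49] -/
theorem act_eq_of_comm_ker (J : Subgroup D.DeltaHat)
    {V : Type*} (act : D.DeltaHat → V → V) (Ks : Subgroup D.DeltaHat)
    (Pv : V → Subgroup D.DeltaHat)
    (hequiv : ∀ (b : D.DeltaHat) (v : V), ∃ j ∈ J,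
      (Pv v).map (MulAut.conj b).toMonoidHom = (Pv (act b v)).map (MulAut.conj j).toMonoidHom)
    (hA3 : ∀ (v w : V), ∀ g ∈ J, ∀ h ∈ J,
      (∃ x ∈ (Pv v).map (MulAut.conj g).toMonoidHom ⊓ (Pv w).map (MulAut.conj h).toMonoidHom,
        ∃ y ∈ (Pv v).map (MulAut.conj g).toMonoidHom ⊓ (Pv w).map (MulAut.conj h).toMonoidHom,
          x * y * x⁻¹ * y⁻¹ ∉ Ks) → v = w)
    (Jv : V → Subgroup D.DeltaHat) (hJvP : ∀ v, Jv v ≤ Pv v) (hJvJ : ∀ v, Jv v ≤ J)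
    (hdag : ∀ v, ∃ x ∈ Jv v ⊓ D.ρHat.ker, ∃ y ∈ Jv v ⊓ D.ρHat.ker, x * y * x⁻¹ * y⁻¹ ∉ Ks)
    (a : D.DeltaHat) (ha : ∀ x ∈ J, x ∈ D.ρHat.ker → a * x = x * a) (v : V) : act a v = v := by
  obtain ⟨x, ⟨hxv, hxk⟩, y, ⟨hyv, hyk⟩, hxy⟩ := hdag v
  obtain ⟨j, hjJ, hj⟩ := hequiv a v
  -- an element of `J_v ∩ Ker(Δ̂_X ↠ Π̂_𝔾)` is fixed by `α`, so lies in `P_v ∩ α P_v α⁻¹ = P_v ∩ j P_{α·v} j⁻¹`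
  have hmem : ∀ z ∈ Jv v, z ∈ D.ρHat.ker →
      z ∈ (Pv v).map (MulAut.conj (1 : D.DeltaHat)).toMonoidHom ⊓
        (Pv (act a v)).map (MulAut.conj j).toMonoidHom := by
    intro z hzv hzk
    have hc : a * z = z * a := ha z (hJvJ v hzv) hzk
    refine ⟨⟨z, hJvP v hzv, by simp⟩, ?_⟩
    rw [← hj]
    refine ⟨z, hJvP v hzv, ?_⟩
    change a * z * a⁻¹ = z
    rw [hc, mul_inv_cancel_right]
  exact (hA3 v (act a v) 1 J.one_mem j hjJ ⟨x, hmem x hxv hxk, y, hmem y hyv hyk, hxy⟩).symm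

/-- **[IUTchI] Cor. 2.3 (iii), first sentence, ONE LEVEL `J`, condition (a), KERNEL FORM**: every
`α ∈ Δ̂_X` commuting with `J ∩ Ker(Δ̂_X ↠ Π̂_𝔾)` lies in `J` — from EXACTLY the printed per-level
inputs of abc-iut-w4-d070's `mem_level_of_comm_of_inputs` (vertices `V` of the dual graph of the
special fibre of `𝔛_J` with the `Δ̂_X`-action `act`; `Ks = Ker(J ↠ J*)`; the `P_v` (`hequiv`);
**(A3)** = [AbsTopII] Prop. 1.3 (iv) / [NodNon] Prop. 3.9 (i) at level `J` (`hA3`); the decomposition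
groups `J_v` (`hJvP`, `hJvJ`, `hJvc`); the prime `l ∉ Σ` (`hl`); the maximal pro-`l` quotients
`ql v : J_v ↠ L v` (continuous, surjective, pro-`l`, nonabelian, killing `J_v ∩ Ks`); "the image of
`J_v` in `Π̂_𝔾` is pro-`Σ`" (`hSigv`); the [SemiAnbd] Cor. 3.11 step (`TrivOn`, `h311`); `(J*)^{ab}`
as a torsion-free `ℤ[Δ̂_X]`-module `A` (`ρab`, `hinner`), the unipotence step (`hunip`) and the
[Config] Prop. 1.4 faithfulness step (`hfaith`) — see that theorem's docstring for the print
locators of each).  The proof is abc-iut-w4-d070's, whose commutation premise is only ever applied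
to elements of "`Ker(J_v ⊆ J ⊆ Δ̂_X ↠ Π̂_𝔾) ⊆ J_v ∩ J_ℍ`" (p. 49 l. 9–10); hence the conclusion for
the weaker, `ℍ`-free premise. [cite: Mochizuki2012, Cor 2.3(iii) pp.48-49] -/
theorem mem_level_of_comm_ker_of_inputs (hΔc : IsClosed (D.DeltaHat : Set D.PiHat))
    [T2Space D.graph.Hat] (hρc : Continuous D.ρHat)
    (J : Subgroup D.DeltaHat) [J.Normal] (hJo : IsOpen (J : Set D.DeltaHat))
    {V : Type*} (act : D.DeltaHat → V → V) (Ks : Subgroup D.DeltaHat)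
    (Pv : V → Subgroup D.DeltaHat)
    (hequiv : ∀ (b : D.DeltaHat) (v : V), ∃ j ∈ J,
      (Pv v).map (MulAut.conj b).toMonoidHom = (Pv (act b v)).map (MulAut.conj j).toMonoidHom)
    (hA3 : ∀ (v w : V), ∀ g ∈ J, ∀ h ∈ J,
      (∃ x ∈ (Pv v).map (MulAut.conj g).toMonoidHom ⊓ (Pv w).map (MulAut.conj h).toMonoidHom,
        ∃ y ∈ (Pv v).map (MulAut.conj g).toMonoidHom ⊓ (Pv w).map (MulAut.conj h).toMonoidHom,
          x * y * x⁻¹ * y⁻¹ ∉ Ks) → v = w)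
    (Jv : V → Subgroup D.DeltaHat) (hJvP : ∀ v, Jv v ≤ Pv v) (hJvJ : ∀ v, Jv v ≤ J)
    (hJvc : ∀ v, IsClosed (Jv v : Set D.DeltaHat))
    {l : ℕ} (hl : l ∉ D.graph.Sigma)
    (L : V → Type*) [∀ v, Group (L v)] [∀ v, TopologicalSpace (L v)]
    [∀ v, IsTopologicalGroup (L v)] [∀ v, CompactSpace (L v)]
    [∀ v, TotallyDisconnectedSpace (L v)] [∀ v, T2Space (L v)]
    (ql : ∀ v, Jv v →* L v) (hqlc : ∀ v, Continuous (ql v))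
    (hqls : ∀ v, Function.Surjective (ql v)) (hLl : ∀ v, IsProSigma {l} (L v))
    (hLna : ∀ v, ∃ X Y : L v, X * Y ≠ Y * X)
    (hqlK : ∀ v (x : Jv v), (x : D.DeltaHat) ∈ Ks → ql v x = 1)
    (hSigv : ∀ (v : V) (M : Subgroup (Jv v)), M.Normal → IsOpen (M : Set (Jv v)) →
      (D.ρHat.ker).subgroupOf (Jv v) ≤ M → ∀ p : ℕ, p.Prime → p ∣ M.index → p ∈ D.graph.Sigma)
    (TrivOn : D.DeltaHat → V → Prop)
    (h311 : ∀ (b : D.DeltaHat) (v : V), act b v = v →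
      (∀ X : L v, ∃ x : Jv v, ql v x = X ∧ b * (x : D.DeltaHat) * b⁻¹ = x) → TrivOn b v)
    {A : Type*} [AddCommGroup A] [IsAddTorsionFree A] (ρab : D.DeltaHat →* Module.End ℤ A)
    (hinner : J ≤ ρab.ker)
    (hunip : ∀ b : D.DeltaHat, (∀ v, act b v = v ∧ TrivOn b v) → IsNilpotent (ρab b - 1))
    (hfaith : ∀ b : D.DeltaHat, ρab b = 1 → b ∈ J)
    (a : D.DeltaHat) (ha : ∀ x ∈ J, x ∈ D.ρHat.ker → a * x = x * a) : a ∈ J := by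
  haveI : CompactSpace D.DeltaHat := isCompact_iff_compactSpace.mp hΔc.isCompact
  -- `a` commutes with every element of `J_v ∩ Ker(Δ̂_X ↠ Π̂_𝔾)`, in conjugation form
  have hconj : ∀ v (h : Jv v), (h : D.DeltaHat) ∈ D.ρHat.ker →
      a * (h : D.DeltaHat) * a⁻¹ = h := by
    intro v h hh
    rw [ha h (hJvJ v h.2) hh, mul_inv_cancel_right]
  -- (†), case (a): `N_v := Ker(J_v → Π̂_𝔾)` maps ONTO the maximal pro-`l` quotient `L v`
  have hN : ∀ v, ((D.ρHat.ker).subgroupOf (Jv v)).map (ql v) = ⊤ := by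
    intro v
    haveI : CompactSpace (Jv v) := isCompact_iff_compactSpace.mp (hJvc v).isCompact
    refine map_eq_top_of_proSigma_of_proL hl _ (hSigv v) (ql v) (hqlc v) (hqls v) (hLl v) ?_
    have hkc : IsClosed ((D.ρHat.ker : Subgroup D.DeltaHat) : Set D.DeltaHat) := by
      have e : ((D.ρHat.ker : Subgroup D.DeltaHat) : Set D.DeltaHat) = D.ρHat ⁻¹' {1} := by
        ext x; exact MonoidHom.mem_ker
      rw [e]
      exact isClosed_singleton.preimage hρc
    have hc : IsCompact (((D.ρHat.ker).subgroupOf (Jv v) : Subgroup (Jv v)) : Set (Jv v)) :=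
      (hkc.preimage continuous_subtype_val).isCompact
    rw [Subgroup.coe_map]
    exact (hc.image (hqlc v)).isClosed
  -- every element of `L v` lifts to `N_v`
  have hlift : ∀ v (X : L v), ∃ h : Jv v, (h : D.DeltaHat) ∈ D.ρHat.ker ∧ ql v h = X := by
    intro v X
    have hX : X ∈ ((D.ρHat.ker).subgroupOf (Jv v)).map (ql v) := by rw [hN v]; trivial
    obtain ⟨h, hh, rfl⟩ := Subgroup.mem_map.mp hX
    exact ⟨h, Subgroup.mem_subgroupOf.mp hh, rfl⟩
  -- (†) in the currency of (A3): `N_v` is nonabelian modulo `Ks`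
  have hdag : ∀ v, ∃ x ∈ Jv v ⊓ D.ρHat.ker, ∃ y ∈ Jv v ⊓ D.ρHat.ker,
      x * y * x⁻¹ * y⁻¹ ∉ Ks := by
    intro v
    obtain ⟨X, Y, hXY⟩ := hLna v
    obtain ⟨x, hxk, rfl⟩ := hlift v X
    obtain ⟨y, hyk, rfl⟩ := hlift v Y
    refine ⟨x, ⟨x.2, hxk⟩, y, ⟨y.2, hyk⟩, fun hK => hXY ?_⟩
    have h1 : ql v (x * y * x⁻¹ * y⁻¹) = 1 := hqlK v _ (by simpa using hK)
    rw [map_mul, map_mul, map_mul, map_inv, map_inv, mul_inv_eq_one, mul_inv_eq_iff_eq_mul] at h1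
    exact h1
  -- Step 1 ("`α` fixes `v`") and Step 2 (the premise of the [SemiAnbd] Cor. 3.11 step)
  have hfix : ∀ v, act a v = v :=
    D.act_eq_of_comm_ker J act Ks Pv hequiv hA3 Jv hJvP hJvJ hdag a ha
  have htriv : ∀ v (X : L v), ∃ x : Jv v, ql v x = X ∧ a * (x : D.DeltaHat) * a⁻¹ = x := by
    intro v X
    obtain ⟨h, hhk, hhx⟩ := hlift v X
    exact ⟨h, hhx, hconj v h hhk⟩
  -- Step 3: trivial on every component ⇒ unipotent of finite order on `(J*)^{ab}` ⇒ trivial ⇒ `a ∈ J`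
  have hnil : IsNilpotent (ρab a - 1) :=
    hunip a fun v => ⟨hfix v, h311 a v (hfix v) (htriv v)⟩
  haveI : Finite (D.DeltaHat ⧸ J) := Subgroup.quotient_finite_of_isOpen J hJo
  have hpow : ρab a ^ J.index = 1 := by
    rw [← map_pow]
    exact (MonoidHom.mem_ker).mp (hinner (J.pow_index_mem a))
  exact hfaith a
    (moduleEnd_eq_one_of_isNilpotent_sub_one_of_pow_eq_one hnil J.index_ne_zero_of_finite hpow)

/-! ### D′. The typed field from the `ℍ`-free level conclusions -/

/-- **[IUTchI] Cor. 2.3 (iii), first sentence, AS THE FIELD `Cor23iii.slim`, from the `ℍ`-FREE level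
conclusions**: splitting on (a)/(b) as the text does (p. 48), with (KER-LEVEL) supplied under (a)
(`hA`, from `mem_level_of_comm_ker_of_inputs` at each level) and under (b) (`hB`, abstract — the
[Tama2] branch is not kernelised, as in the predecessor file).  Same conclusion type as
abc-iut-w4-d070's `slim_of_cor23Hyp_of_levels` and as the hypothesis `hslim` of the kernel of
record `cor23iii_of_slim`. [cite: Mochizuki2012, Cor 2.3(iii) pp.47-49] -/
theorem slim_of_cor23Hyp_of_ker_levels [T2Space D.PiHat] [TotallyDisconnectedSpace D.PiHat]
    (hΔc : IsClosed (D.DeltaHat : Set D.PiHat)) {I : Type*} (J : I → Subgroup D.DeltaHat)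
    (hcof : ∀ W : Subgroup D.DeltaHat, W.Normal → IsOpen (W : Set D.DeltaHat) → ∃ i, J i ≤ W)
    (hA : (∃ l ∈ D.graph.SigmaHat, l ∉ D.graph.Sigma ∧ l ≠ D.p) →
      ∀ i (a : D.DeltaHat), (∀ x ∈ J i, x ∈ D.ρHat.ker → a * x = x * a) → a ∈ J i)
    (hB : D.graph.SigmaHat = {q | q.Prime} →
      ∀ i (a : D.DeltaHat), (∀ x ∈ J i, x ∈ D.ρHat.ker → a * x = x * a) → a ∈ J i) :
    D.Cor23Hyp → IsSlimGroup D.deltaHatH := fun hyp =>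
  hyp.out.elim (fun ha => D.isSlimGroup_deltaHatH_of_ker_levels hΔc J hcof (hA ha))
    fun hb => D.isSlimGroup_deltaHatH_of_ker_levels hΔc J hcof (hB hb)

/-- **Every intermediate subgroup is slim under `Cor23Hyp`** from the same `ℍ`-free level
conclusions: for `Ker(Δ̂_X ↠ Π̂_𝔾) ⊆ S ⊆ Δ̂_X` (e.g. the `Δ̂_{X,ℍ′}` of any other sub-semi-graph
`ℍ′`, or `Δ̂_X`), `D.Cor23Hyp → IsSlimGroup S`. [cite: Mochizuki2012, Cor 2.3(iii) pp.47-49] -/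
theorem slim_of_cor23Hyp_of_ker_levels_of_le [T2Space D.PiHat] [TotallyDisconnectedSpace D.PiHat]
    (hΔc : IsClosed (D.DeltaHat : Set D.PiHat)) (S : Subgroup D.DeltaHat) (hS : D.ρHat.ker ≤ S)
    {I : Type*} (J : I → Subgroup D.DeltaHat)
    (hcof : ∀ W : Subgroup D.DeltaHat, W.Normal → IsOpen (W : Set D.DeltaHat) → ∃ i, J i ≤ W)
    (hA : (∃ l ∈ D.graph.SigmaHat, l ∉ D.graph.Sigma ∧ l ≠ D.p) →
      ∀ i (a : D.DeltaHat), (∀ x ∈ J i, x ∈ D.ρHat.ker → a * x = x * a) → a ∈ J i)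
    (hB : D.graph.SigmaHat = {q | q.Prime} →
      ∀ i (a : D.DeltaHat), (∀ x ∈ J i, x ∈ D.ρHat.ker → a * x = x * a) → a ∈ J i) :
    D.Cor23Hyp → IsSlimGroup S := fun hyp =>
  hyp.out.elim (fun ha => D.isSlimGroup_of_ker_le_of_levels hΔc S hS J hcof (hA ha))
    fun hb => D.isSlimGroup_of_ker_le_of_levels hΔc S hS J hcof (hB hb)

end StableCurveTemperedData

end Literature.IUT.HodgeTheaters
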